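import Summits.FinalStateConjecture.FinalStateConjecture.Theses.RobustClausewiseGenericity
import Literature.Geometry.Lorentzian.AFEndBreathingFamily
import Literature.Geometry.Lorentzian.AdmissibleDataLocality
import HarnessLib

/-!
# `GaugeEnrichment` (item stmt-FinalStateConjecture-10133, route `RobustClausewiseGenericity`) — PROVED

The injectivity device of the robust-escapability routes of summit `FinalStateConjecture`
(`RobustClausewiseGenericity.Assembly`, and by name the line `hair-vacates-the-margin` of crux
`GenericCensorshipCollarMargin`, stmt-10809, whose composition `GenericCensorshipCollarMarginC2_of` takes
`GaugeEnrichment` as a hypothesis): for every admissible datum `d` on a connected Hausdorff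
second-countable `3`-manifold `X` and every TAME probe `G : ℝᵐ → data` through `d` (jointly smooth,
admissible members, agreeing with `d` off one compact set) there are a tame `G₁ : ℝ^{m+1} → data`, an
injective linear `L` with `G₁ ∘ L = G`, a direction `w` and a functional `Λ` with `Λ ∘ G₁` of class
`C¹` and `d(Λ ∘ G₁)(0) w ≠ 0`.

Construction (the planner's, realised with the tree's breathing machinery): `d` is admissible, so it
has an asymptotically flat end `e`; far out on it sits a coordinate ball `ball z₀ 1`,
`‖z₀‖ = R + 3` (`AFEnd.BreathingData`). Put

  `G₁ q := (breathe (σ (q_last)))^* (G (init q))`   (`AFEnd.breatheFamily`),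

the pull-back of the member `G (init q)` along the breathing immersion of `X` supported in that ball,
`σ` the squashing of `ℝ` onto the immersion range; `L c := (c, 0)`; `w := e_last`;
`Λ(D) := h_D(x₀)(v₀, v₀)` at the centre `x₀ = Φₑ z₀`. Then: tameness — joint smoothness is
`AFEnd.contMDiff_breatheFamily_family_h/k` (`AFEndBreathingFamily.lean`), `G₁ 0 = d` and
`G₁ (L c) = G c` by `breathe 0 = id`, admissibility by naturality of the vacuum constraints under local
diffeomorphisms (`isVacuumConstraintSolution_breatheFamily`) and locality of admissibility
(`mem_admissibleVacuumData_of_agree_off_compact`), agreement with `d` off `K ∪ breatheCore`; the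
marker — `Λ(G₁ q) = (1 + σ(q_last))² h_{G (init q)}(x₀)(v₀, v₀)` (`breatheFamily_h_inner_center`), a
smooth function (the smooth family read in the trivialisation at `x₀`), whose derivative at `0` along
`w` is `2σ'(0) h_d(x₀)(v₀, v₀) = 2 (s₀/π) h_d(x₀)(v₀, v₀) > 0`.

No named facts; no definitions (the two coordinate maps are packaged as existence lemmas).

## References

* R. Bartnik, J. Isenberg, *The constraint equations* (2004), §2. [BartnikIsenberg2004]
* D. Christodoulou, CQG 16 (1999) A23, p. A24 (families of admissible data). [Christodoulou1999]
* J. M. Lee, *Introduction to Smooth Manifolds*, 2nd ed. (2013), Ch. 2, Prop. 2.25. [LeeSmoothManifolds2013]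
-/

noncomputable section

namespace Summit.FinalStateConjecture.FinalStateConjecture.Theorems.RobustClausewiseGenericity

open Literature.Geometry.Lorentzian Literature.Geometry.Lorentzian.AFEnd
open Bundle Set Function Filter Metric
open scoped Manifold ContDiff Topology

-- D-0017: single-problem summit, `Summit.<S>.<S>.…` by design.
set_option linter.dupNamespace false

/-- Forgetting the last coordinate: `ℝ^{m+1} → ℝᵐ`, `(init q)ᵢ = q_{castSucc i}`. [folklore] -/
theorem initCLM_exists (m : ℕ) : ∃ pr : EuclideanSpace ℝ (Fin (m + 1)) →L[ℝ] EuclideanSpace ℝ (Fin m),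
    ∀ q i, pr q i = q (Fin.castSucc i) :=
  ⟨(EuclideanSpace.equiv (Fin m) ℝ).symm.toContinuousLinearMap.comp
    (ContinuousLinearMap.pi fun i : Fin m ↦ EuclideanSpace.proj (𝕜 := ℝ) (Fin.castSucc i)),
    fun q i ↦ by simp⟩

/-- Appending a zero last coordinate: a linear `ℝᵐ → ℝ^{m+1}` with `(L c)_{castSucc i} = cᵢ`,
`(L c)_{last} = 0`. [folklore] -/
theorem snocLM_exists (m : ℕ) : ∃ L : EuclideanSpace ℝ (Fin m) →ₗ[ℝ] EuclideanSpace ℝ (Fin (m + 1)),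
    (∀ c i, L c (Fin.castSucc i) = c i) ∧ ∀ c, L c (Fin.last m) = 0 :=
  ⟨(EuclideanSpace.equiv (Fin (m + 1)) ℝ).symm.toLinearEquiv.toLinearMap ∘ₗ
    (LinearMap.pi fun j : Fin (m + 1) ↦
      Fin.lastCases (motive := fun _ ↦ EuclideanSpace ℝ (Fin m) →ₗ[ℝ] ℝ) 0
        (fun i ↦ (EuclideanSpace.proj (𝕜 := ℝ) i).toLinearMap) j),
    fun c i ↦ by simp, fun c ↦ by simp⟩

/-- **GAUGE ENRICHMENT** (item stmt-FinalStateConjecture-10133 of route `RobustClausewiseGenericity`,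
the injectivity device of its assembly and of every robust-escapability line): every tame probe
`G : ℝᵐ → data` through an admissible datum `d` enriches to the tame probe
`G₁(c, s) := (breathe (σ s))^* (G c)` — pull-back along the breathing immersions of `X` supported in
a coordinate ball of the asymptotically flat end of `d` (`AFEndBreathing*.lean`), `σ` the squashing
of `ℝ` onto the immersion range — along `L c = (c, 0)`, and the functional
`Λ(D) := h_D(x₀)(v₀, v₀)` at the centre `x₀` of the ball has `Λ(G₁(c, s)) = (1 + σ s)² h_{G c}(x₀)(v₀, v₀)`,
smooth with `∂_s|₀ = 2σ'(0) h_d(x₀)(v₀, v₀) ≠ 0`. Admissibility and tameness are preserved because the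
deformation is a constraint-natural pull-back supported in a compact set
(`isVacuumConstraintSolution_breatheFamily`, `mem_admissibleVacuumData_of_agree_off_compact`); joint
smoothness is `contMDiff_breatheFamily_family_h/k`. [cite: BartnikIsenberg2004, §2] -/
theorem gaugeEnrichment :
    Summit.FinalStateConjecture.FinalStateConjecture.Theses.RobustClausewiseGenericity.GaugeEnrichment := by
  intro X _ _ _ _ _ _ d hd Tame m G hG
  obtain ⟨hGs, hG0, hGadm, K, hK, hGK⟩ := hG
  -- the asymptotically flat end of `d` and a breathing ball far out on it
  obtain ⟨-, e, Mass, hsole, hdecay⟩ := hd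
  set z₀ : E3 := (e.R + 3) • EuclideanSpace.single (0 : Fin 3) (1 : ℝ) with hz₀
  have hz₀n : ‖z₀‖ = e.R + 3 := by
    rw [hz₀, norm_smul, PiLp.norm_single, norm_one, mul_one,
      Real.norm_of_nonneg (by linarith [e.R_pos])]
  have B : e.BreathingData z₀ 1 := ⟨one_pos, by rw [hz₀n]; linarith⟩
  -- parameter bookkeeping on `ℝ^{m+1} = ℝᵐ × ℝ`
  obtain ⟨pr, hpr⟩ := initCLM_exists m
  set τ : EuclideanSpace ℝ (Fin (m + 1)) →L[ℝ] ℝ := EuclideanSpace.proj (Fin.last m) with hτ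
  obtain ⟨L, hL1, hL2⟩ := snocLM_exists m
  have hprL : ∀ c, pr (L c) = c := fun c ↦ by
    ext i
    rw [hpr, hL1]
  have hτL : ∀ c, τ (L c) = 0 := fun c ↦ by
    rw [hτ]
    exact hL2 c
  -- the enriched family, the direction and the functional
  set G₁ : EuclideanSpace ℝ (Fin (m + 1)) → InitialDataSet (𝓡 3) X :=
    fun q ↦ breatheFamily B (G (pr q)) (τ q) with hG₁
  set w : EuclideanSpace ℝ (Fin (m + 1)) := EuclideanSpace.single (Fin.last m) (1 : ℝ) with hw
  set x₀ : X := e.dataChartExt z₀ with hx₀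
  set v₀ : TangentSpace (𝓡 3) x₀ := (EuclideanSpace.single (0 : Fin 3) (1 : ℝ) : E3) with hv₀
  have hv₀ne : v₀ ≠ 0 := by
    have h : (EuclideanSpace.single (0 : Fin 3) (1 : ℝ) : E3) ≠ 0 := by
      rw [← norm_ne_zero_iff, PiLp.norm_single, norm_one]
      exact one_ne_zero
    exact h
  set Λ : InitialDataSet (𝓡 3) X → ℝ := fun D ↦ D.h.inner x₀ v₀ v₀ with hΛ
  have hA : 0 < d.h.inner x₀ v₀ v₀ := d.h.pos x₀ v₀ hv₀ne
  -- coordinates of the direction `w`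
  have hprw : pr w = 0 := by
    ext i
    rw [hpr, hw, PiLp.single_apply, if_neg (Fin.castSucc_lt_last i).ne]
    rfl
  have hτw : τ w = 1 := by
    rw [hτ, hw]
    show (EuclideanSpace.single (Fin.last m) (1 : ℝ) : EuclideanSpace ℝ (Fin (m + 1))) (Fin.last m) = 1
    rw [PiLp.single_apply, if_pos rfl]
  -- `Λ ∘ G₁` in closed form: `(1 + σ(τ q))² · h_{G (pr q)}(x₀)(v₀, v₀)`
  have hΛG : Λ ∘ G₁ = fun q ↦ (1 + squash B (τ q)) ^ 2 * (G (pr q)).h.inner x₀ v₀ v₀ := by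
    funext q
    exact breatheFamily_h_inner_center B (G (pr q)) (τ q) v₀ v₀
  -- `c ↦ h_{G c}(x₀)(v₀, v₀)` is smooth (read the smooth family in the trivialisation at `x₀`)
  have hF : ContDiff ℝ ∞ (fun c : EuclideanSpace ℝ (Fin m) ↦ (G c).h.inner x₀ v₀ v₀) := by
    set T := trivializationAt E3 (TangentSpace (𝓡 3) : X → Type _) x₀ with hT
    have h1 : ContMDiff 𝓘(ℝ, EuclideanSpace ℝ (Fin m)) ((𝓡 3).prod 𝓘(ℝ, E3 →L[ℝ] E3 →L[ℝ] ℝ)) ∞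
        (fun c : EuclideanSpace ℝ (Fin m) ↦ TotalSpace.mk' (E3 →L[ℝ] E3 →L[ℝ] ℝ)
          (E := fun x : X ↦ TangentSpace (𝓡 3) x →L[ℝ] TangentSpace (𝓡 3) x →L[ℝ] ℝ) x₀
          ((G c).h.inner x₀)) :=
      hGs.1.comp (contMDiff_id.prodMk contMDiff_const)
    have h2 : ContMDiff 𝓘(ℝ, EuclideanSpace ℝ (Fin m)) 𝓘(ℝ, E3 →L[ℝ] E3 →L[ℝ] ℝ) ∞
        (fun c : EuclideanSpace ℝ (Fin m) ↦ (ContinuousLinearMap.precomp ℝ (T.symmL ℝ x₀)).comp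
          (((G c).h.inner x₀).comp (T.symmL ℝ x₀))) := fun c ↦
      ((contMDiffAt_bilin_iff (IX := 𝓘(ℝ, EuclideanSpace ℝ (Fin m))) (IB := 𝓡 3)
        (V := (TangentSpace (𝓡 3) : X → Type _)) (b := fun _ : EuclideanSpace ℝ (Fin m) ↦ x₀)
        (s := fun c : EuclideanSpace ℝ (Fin m) ↦ (G c).h.inner x₀) (x₀ := c)).1 (h1 c)).2
    have h3 : ContDiff ℝ ∞ (fun c : EuclideanSpace ℝ (Fin m) ↦ (ContinuousLinearMap.precomp ℝ (T.symmL ℝ x₀)).comp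
          (((G c).h.inner x₀).comp (T.symmL ℝ x₀))) := contMDiff_iff_contDiff.1 h2
    have hx₀T : x₀ ∈ T.baseSet := FiberBundle.mem_baseSet_trivializationAt' x₀
    set u : E3 := T.continuousLinearMapAt ℝ x₀ v₀ with hu
    have hsu : T.symmL ℝ x₀ u = v₀ := T.symmL_continuousLinearMapAt hx₀T v₀
    have h4 : (fun c : EuclideanSpace ℝ (Fin m) ↦ (G c).h.inner x₀ v₀ v₀) =
        fun c ↦ ((ContinuousLinearMap.precomp ℝ (T.symmL ℝ x₀)).comp
          (((G c).h.inner x₀).comp (T.symmL ℝ x₀))) u u := by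
      funext c
      simp only [ContinuousLinearMap.coe_comp, Function.comp_apply, ContinuousLinearMap.precomp_apply, hsu]
    rw [h4]
    exact (h3.clm_apply contDiff_const).clm_apply contDiff_const
  have hC : ContDiff ℝ ∞ (Λ ∘ G₁) := by
    rw [hΛG]
    exact ((contDiff_const.add ((contDiff_squash B (n := ⊤)).comp τ.contDiff)).pow 2).mul
      (hF.comp pr.contDiff)
  have hC1 : ContDiff ℝ 1 (Λ ∘ G₁) := hC.of_le (by exact_mod_cast le_top)
  refine ⟨G₁, L, w, Λ, ?_, ⟨?_, ?_, ?_, ?_⟩, ?_, hC1, ?_⟩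
  · -- `L` is injective (`pr ∘ L = id`)
    exact Function.LeftInverse.injective hprL
  · -- joint smoothness
    exact ⟨contMDiff_breatheFamily_family_h B pr.contDiff τ.contDiff hGs.1,
      contMDiff_breatheFamily_family_k B pr.contDiff τ.contDiff hGs.2⟩
  · -- `G₁ 0 = d`
    show breatheFamily B (G (pr 0)) (τ 0) = d
    rw [map_zero, map_zero, breatheFamily_zero, hG0]
  · -- admissibility (vacuum by naturality, end untouched)
    intro q
    refine InitialDataSet.mem_admissibleVacuumData_of_agree_off_compact (hGadm (pr q)) ?_
      (isCompact_breatheCore B) (fun x hx ↦ breatheFamily_eq_of_not_mem_core B (G (pr q)) (τ q) hx)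
    intro inst
    haveI : (G (pr q)).metric.HasLeviCivita := (G (pr q)).metric.hasLeviCivita
    exact isVacuumConstraintSolution_breatheFamily B (G (pr q)) (hGadm (pr q)).1.1 (τ q)
  · -- tameness: agreement with `d` off `K ∪ breatheCore`
    refine ⟨K ∪ breatheCore e z₀ 1, hK.union (isCompact_breatheCore B), fun q x hx ↦ ?_⟩
    rw [Set.mem_union, not_or] at hx
    obtain ⟨h1, h2⟩ := breatheFamily_eq_of_not_mem_core B (G (pr q)) (τ q) hx.2
    obtain ⟨h3, h4⟩ := hGK (pr q) x hx.1
    exact ⟨h1.trans h3, h2.trans h4⟩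
  · -- `G₁ (L c) = G c`
    intro c
    show breatheFamily B (G (pr (L c))) (τ (L c)) = G c
    rw [hprL, hτL, breatheFamily_zero]
  · -- the marker: `d(Λ ∘ G₁)(0) w = 2 σ'(0) h_d(x₀)(v₀, v₀) ≠ 0`
    have hline : (fun t : ℝ ↦ (Λ ∘ G₁) (t • w)) = fun t ↦ (1 + squash B t) ^ 2 * d.h.inner x₀ v₀ v₀ := by
      funext t
      rw [hΛG]
      simp only [map_smul, hprw, hτw, smul_zero, smul_eq_mul, mul_one, hG0]
    have hsq : HasDerivAt (squash B) (breatheScale B / Real.pi) 0 := by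
      have h := (Real.hasDerivAt_arctan 0).const_mul (breatheScale B / Real.pi)
      simp only [ne_eq, OfNat.ofNat_ne_zero, not_false_eq_true, zero_pow, add_zero, div_one, mul_one] at h
      exact h
    have hg : HasDerivAt (fun t : ℝ ↦ (1 + squash B t) ^ 2 * d.h.inner x₀ v₀ v₀)
        (((2 : ℕ) * (1 + squash B 0) ^ (2 - 1) * (breatheScale B / Real.pi)) * d.h.inner x₀ v₀ v₀) 0 :=
      ((hsq.const_add 1).pow 2).mul_const _
    have hdiff : DifferentiableAt ℝ (Λ ∘ G₁) ((0 : ℝ) • w) := by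
      rw [zero_smul]
      exact hC1.differentiable one_ne_zero 0
    have hcomp : HasDerivAt (fun t : ℝ ↦ (Λ ∘ G₁) (t • w)) (fderiv ℝ (Λ ∘ G₁) ((0 : ℝ) • w) w) 0 := by
      have h1 : HasDerivAt (fun t : ℝ ↦ t • w) w 0 := by
        simpa using (hasDerivAt_id (0 : ℝ)).smul_const w
      exact hdiff.hasFDerivAt.comp_hasDerivAt (0 : ℝ) h1
    rw [zero_smul] at hcomp
    rw [hline] at hcomp
    rw [hcomp.unique hg, squash_zero]
    have hs₀ := (breatheScale_spec B).1
    positivity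

end Summit.FinalStateConjecture.FinalStateConjecture.Theorems.RobustClausewiseGenericity

end
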